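import Mathlib.LinearAlgebra.FiniteDimensional.Basic
import Mathlib.LinearAlgebra.FiniteDimensional.Lemmas
import Mathlib.LinearAlgebra.Dimension.Finite
import Mathlib.Tactic.Ring
import Mathlib.Tactic.NormNum
import Mathlib.Tactic.Linarith
import HarnessLib

/-!
# NSC(−2) · the kernel shadow of LEMMA KER (carver C835 (b), prover 2 gen 35): the obstruction space `K_Z = ker σ`, the count
# `h¹(N_Z) − rank c = dim K_Z + (rank σ − rank c)`, and the decision table — five def-free linear-algebra heads

Family `hodge`, b2b cell `hweil` (helper of item stmt-HodgeConjecture-2524; cell target NSC(−2) =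
`Ring2.Hypotheses.WeilClassesComponent 3 3 [−2]`). Order LADDER `## CARVER v139` C835 (e) (2) for pv2-g35: «the kernel shadow of LEMMA KER (≤ 5
def-free heads, ONE file `…NscKer`: finrank W − rank c = finrank (ker σ) + (rank σ − rank c); ker σ = ⊥ → rank σ = finrank W; (iv) as
propositional bookkeeping)». An `Nsc` file (C807 (d)) with NO `Ring2*` import; Mathlib + HarnessLib only. Companion of
`WeilTypeLadderNscLift` (LEMMA LIFT, C831 (b): `ob(ker c) ⊆ ker σ`, `rank ob = rank c + r_⊥`) and of
`WeilTypeLadderNscSeedsThree.nsc3_test_of_rank_eq` (the 27-test).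

THE DICTIONARY (C831 (b) / C835 (b), seat level; nothing of it is formalised beyond the linear algebra): `X` a member of the `(3,3,[−2])`
component, `Z ⊂ X` lci of codimension `3` (or an object `G`) with class `q·h³ + w`, `w ≠ 0`; `V = H¹(T_X)`, `W = H¹(N_Z)` (or `Ext²(G,G)`),
`U = H⁴(Ω²_X)`; `ob : V → W` the first-order obstruction map, `σ : W → U` the semiregularity map, `c = σ ∘ ob` (Bloch's compatibility; `rank c = 27`
in H-27), `K_Z := ker σ` (Bloch: along an arc on which the class stays Hodge EVERY obstruction `O′_{m+1}(Z_m)` lies in `K_Z`), `r_⊥ := dim ker c −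
dim ker ob`.
* `nsc_ker_bound` — (i) + the quantitative form of C835 (b)(iii)'s «r_⊥ > 0 suffices»: `ob(ker c) ⊆ K_Z` and **`r_⊥ ≤ dim K_Z`**
  (`ob` restricted to `ker c` has kernel `ker ob` and image inside `ker σ`).
* `nsc_ker_count` — (iii): `dim W = dim K_Z + rank σ`, `rank c ≤ rank σ ≤ dim U`, hence over `ℤ`
  **`dim W − rank c = dim K_Z + (rank σ − rank c)`**: «h¹(N_Z) ≠ rank c» alone closes nothing — it obliges the computation of `rank σ`.
* `nsc_ker_injective_iff` — (ii)/(v): `K_Z = ⊥ ↔ rank σ = dim W`, and `K_Z = ⊥` kills every element of `W` that `σ` kills (every obstruction):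
  WHAT to compute after `r_⊥` is `rank σ`.
* `nsc_ker_test` — the 27-TEST is SUFFICIENT: `dim W = rank c → K_Z = ⊥ ∧ rank σ = rank c = dim W`.
* `nsc_ker_decision` — (iv) as propositional bookkeeping: with `r_⊥ ≤ dim K` exactly one of `r_⊥ > 0` (NEGATIVE), `r_⊥ = 0 ∧ K = 0` (POSITIVE),
  `r_⊥ = 0 ∧ K ≠ 0` (UNDECIDED at first order) holds; the 27-test instance `h = k + s, 27 ≤ s, h = 27 ⟹ k = 0 ∧ s = 27`; and the NOT-NECESSARY
  instance `(h, k, s, rank c) = (28, 0, 28, 27)` (semiregular, yet `h¹ ≠ 27`).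

HONEST FRAMING: elementary linear algebra named by the cell lead to fix WHAT the test generation computes (`r_⊥`, then `rank σ`) and to remove a
false negative from K7's wording; nothing here is a rung, a candidate or evidence for NSC(−2); LEMMA KER's geometric input (Bloch 1972, Thm 2.3 /
2.4 in Voisin's account: the obstruction tower lies in `ker σ` and vanishes when `σ` is injective) is NOT formalised and NOT cited as a fact; no
statement of [Markman 2025] / [Perry 2026] is used; `HC_CM` occurs nowhere. [cite: Bloch1972Semiregularity, §6–§7]
[cite: BuchweitzFlenner2003, Thm. 5.2]
-/

-- mandated namespace `Summit.HodgeConjecture.HodgeConjecture.…` (Problem = Summit) trips `linter.dupNamespace`; the lakefile disables it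
-- tree-wide (weak option), restated here so stand-alone elaboration is warning-free too.
set_option linter.dupNamespace false

namespace Summit.HodgeConjecture.HodgeConjecture.WeilTypeLadder

section NscKer

variable {F V W U : Type*} [Field F] [AddCommGroup V] [Module F V] [AddCommGroup W] [Module F W]
  [AddCommGroup U] [Module F U]

open Module LinearMap

/-- **LEMMA KER (i) + the bound behind «r_⊥ > 0 suffices».** For `c = σ ∘ ob`: `ob(ker c) ⊆ ker σ = K_Z`, and
`dim ker c − dim ker ob ≤ dim K_Z`, i.e. `r_⊥ ≤ dim K_Z` (restrict `ob` to `ker c`: its kernel is `ker ob`, its image lies in `ker σ`).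
[cite: Bloch1972Semiregularity, §6–§7] -/
theorem nsc_ker_bound [FiniteDimensional F V] [FiniteDimensional F W] (ob : V →ₗ[F] W) (σ : W →ₗ[F] U) :
    Submodule.map ob (ker (σ ∘ₗ ob)) ≤ ker σ ∧
    finrank F (ker (σ ∘ₗ ob)) - finrank F (ker ob) ≤ finrank F (ker σ) := by
  have hmap : Submodule.map ob (ker (σ ∘ₗ ob)) ≤ ker σ := by
    rintro w ⟨v, hv, rfl⟩
    simpa [mem_ker] using hv
  refine ⟨hmap, ?_⟩
  -- rank–nullity for the restriction of `ob` to `ker c`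
  set p : Submodule F V := ker (σ ∘ₗ ob) with hp
  have hle : ker ob ≤ p := ker_le_ker_comp ob σ
  have hrn := finrank_range_add_finrank_ker (ob.domRestrict p)
  have hrange : range (ob.domRestrict p) = Submodule.map ob p := range_domRestrict p ob
  have hker : ker (ob.domRestrict p) = Submodule.comap p.subtype (ker ob) := ker_domRestrict p ob
  have hkereq : finrank F (ker (ob.domRestrict p)) = finrank F (ker ob) := by
    rw [hker]
    exact LinearEquiv.finrank_eq (Submodule.comapSubtypeEquivOfLe hle)
  have himg : finrank F (range (ob.domRestrict p)) ≤ finrank F (ker σ) := by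
    rw [hrange]
    exact Submodule.finrank_mono hmap
  have hp' : finrank F (↥p) = finrank F (ker (σ ∘ₗ ob)) := rfl
  omega

/-- **LEMMA KER (iii), the count.** `dim W = dim ker σ + rank σ` (rank–nullity), `rank (σ ∘ ob) ≤ rank σ ≤ dim U`; hence, over `ℤ`,
`dim W − rank c = dim K_Z + (rank σ − rank c)` for `c = σ ∘ ob`: the difference `h¹(N_Z) − rank c` splits into the obstruction space and the
rank defect of `σ` over `c`, and «h¹(N_Z) ≠ rank c» alone decides neither. [cite: BuchweitzFlenner2003, Thm. 5.2] -/
theorem nsc_ker_count [FiniteDimensional F W] [FiniteDimensional F U] (ob : V →ₗ[F] W) (σ : W →ₗ[F] U) :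
    finrank F W = finrank F (ker σ) + finrank F (range σ) ∧
    finrank F (range (σ ∘ₗ ob)) ≤ finrank F (range σ) ∧
    finrank F (range σ) ≤ finrank F U ∧
    ((finrank F W : ℤ) - finrank F (range (σ ∘ₗ ob))
        = finrank F (ker σ) + ((finrank F (range σ) : ℤ) - finrank F (range (σ ∘ₗ ob)))) := by
  have h1 := finrank_range_add_finrank_ker σ
  have h2 : finrank F (range (σ ∘ₗ ob)) ≤ finrank F (range σ) :=
    Submodule.finrank_mono (range_comp_le_range ob σ)
  have h3 : finrank F (range σ) ≤ finrank F U := Submodule.finrank_le _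
  refine ⟨by omega, h2, h3, by omega⟩

/-- **LEMMA KER (ii)/(v).** `K_Z = ⊥ ↔ rank σ = dim W` (so the datum to compute after `r_⊥` is `rank σ`), and when `K_Z = ⊥` every element
of `W` killed by `σ` — every obstruction, by Bloch's theorem — vanishes. [cite: Bloch1972Semiregularity, §6–§7] -/
theorem nsc_ker_injective_iff [FiniteDimensional F W] (σ : W →ₗ[F] U) :
    (ker σ = ⊥ ↔ finrank F (range σ) = finrank F W) ∧
    (ker σ = ⊥ → ∀ w : W, σ w = 0 → w = 0) := by
  have hrn := finrank_range_add_finrank_ker σ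
  constructor
  · constructor
    · intro h
      have : finrank F (ker σ) = 0 := by rw [h]; exact finrank_bot F W
      omega
    · intro h
      have h0 : finrank F (ker σ) = 0 := by omega
      exact Submodule.finrank_eq_zero.mp h0
  · intro h w hw
    have : w ∈ ker σ := by simpa [mem_ker] using hw
    rw [h, Submodule.mem_bot] at this
    exact this

/-- **The 27-TEST is sufficient.** If `dim W = rank (σ ∘ ob)` then `σ` is injective (`K_Z = ⊥`) and `rank σ = rank c = dim W`: in H-27,
`h¹(N_Z) = 27 = rank c` forces `K_Z = 0 ∧ rank σ = 27`. [cite: BuchweitzFlenner2003, Thm. 5.2] -/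
theorem nsc_ker_test [FiniteDimensional F W] [FiniteDimensional F U] (ob : V →ₗ[F] W) (σ : W →ₗ[F] U)
    (h : finrank F W = finrank F (range (σ ∘ₗ ob))) :
    ker σ = ⊥ ∧ finrank F (range σ) = finrank F W ∧ finrank F (range σ) = finrank F (range (σ ∘ₗ ob)) := by
  have hrn := finrank_range_add_finrank_ker σ
  have h2 : finrank F (range (σ ∘ₗ ob)) ≤ finrank F (range σ) :=
    Submodule.finrank_mono (range_comp_le_range ob σ)
  have h0 : finrank F (ker σ) = 0 := by omega
  exact ⟨Submodule.finrank_eq_zero.mp h0, by omega, by omega⟩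

/-- **LEMMA KER (iv), the decision table as bookkeeping.** With `r_⊥ ≤ dim K` (head `nsc_ker_bound`): exactly one of `r_⊥ > 0` (NEGATIVE),
`r_⊥ = 0 ∧ K = 0` (POSITIVE: a seed in substance), `r_⊥ = 0 ∧ K > 0` (UNDECIDED at first order) holds, and `r_⊥ > 0 → K > 0`; the 27-test
instance (`h = k + s`, `27 ≤ s`, `h = 27 ⟹ k = 0 ∧ s = 27`); and the NOT-NECESSARY instance `(h, k, s, rank c) = (28, 0, 28, 27)`:
`K = 0` although `h ≠ 27`. [folklore] -/
theorem nsc_ker_decision :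
    (∀ r k : ℕ, r ≤ k →
      ((0 < r) ∨ (r = 0 ∧ k = 0) ∨ (r = 0 ∧ 0 < k)) ∧
      ¬ ((0 < r) ∧ (r = 0 ∧ k = 0)) ∧ ¬ ((0 < r) ∧ (r = 0 ∧ 0 < k)) ∧ ¬ ((r = 0 ∧ k = 0) ∧ (r = 0 ∧ 0 < k)) ∧
      (0 < r → 0 < k)) ∧
    (∀ h k s : ℕ, h = k + s → 27 ≤ s → h = 27 → k = 0 ∧ s = 27) ∧
    ((28 : ℕ) = 0 + 28 ∧ (27 : ℕ) ≤ 28 ∧ (28 : ℕ) ≠ 27 ∧ (28 : ℕ) - 27 = 0 + (28 - 27)) := by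
  refine ⟨fun r k hrk => ⟨by omega, by omega, by omega, by omega, by omega⟩, fun h k s h1 h2 h3 => by omega, by norm_num⟩

end NscKer

end Summit.HodgeConjecture.HodgeConjecture.WeilTypeLadder
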